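import Mathlib
import Summits.Ventures.HodgeRepro.Tier4.Common.AdelicDefs
import Summits.Ventures.HodgeRepro.Tier4.Line1.AdicIntegersCompact

/-!
# Tier4/Line1/C7AdelicBox — boxes in restricted products, in the adele ring and in `M₄(𝔸_k)` are compact
(C7.3b of the C7 census, first half)

Blind re-derivation cell `pub-hodge-repro`, Tier 4, LINE L1, rung C7 (typed census `proofs/t4/L1/C7-rungs-sig.lean`,
t4-L1-p4 with t4-L1-p2).  The Tychonoff half of `isCompact_adelicBox`: a box `∏_{i ∈ s} C i × ∏_{i ∉ s} A i` (finite
`s`, compact `C i`, compact `A i`) is compact in the restricted product `Πʳ i, [R i, A i]` — it is the image under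
the continuous inclusion of the principal restricted product `Πʳ_[𝓟 sᶜ]`, which embeds in `Π i, R i`, of the
preimage of the compact product box (`isCompact_univ_pi`); then the same for the finite adeles (`𝓞_v` compact by
p5's `isCompact_adicCompletionIntegers`), for the adele ring `𝔸_{k,∞} × 𝔸_{k,f}` and, entrywise, for `M₄(𝔸_k)`.
HC_CM is NOT proved by anyone in this repository.
-/

set_option autoImplicit false
noncomputable section
namespace Summit.Ventures.HodgeRepro.Tier4.Line1
open NumberField IsDedekindDomain HeightOneSpectrum Topology Common Filter Set

section RestrictedProductBox

open scoped RestrictedProduct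

variable {ι : Type*} {R : ι → Type*} [∀ i, TopologicalSpace (R i)] {A : (i : ι) → Set (R i)}

/-- **A box in a restricted product is compact**: for a finite `s`, compact `C i` (`i ∈ s`) and compact `A i`, the set
`{x ∈ Πʳ i, [R i, A i] | ∀ i ∈ s, x i ∈ C i, ∀ i ∉ s, x i ∈ A i}` is compact — the image under the continuous
inclusion of `Πʳ_[𝓟 sᶜ]` (which embeds in `Π i, R i`) of the preimage of the compact product box. -/
theorem isCompact_restrictedProduct_box (hA : ∀ i, IsCompact (A i)) (s : Finset ι)
    (C : (i : ι) → Set (R i)) (hC : ∀ i ∈ s, IsCompact (C i)) :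
    IsCompact {x : Πʳ i, [R i, A i] | (∀ i ∈ s, x i ∈ C i) ∧ ∀ i ∉ s, x i ∈ A i} := by
  classical
  have hS : (cofinite : Filter ι) ≤ 𝓟 ((↑s : Set ι)ᶜ) := by
    rw [le_principal_iff, mem_cofinite, compl_compl]
    exact s.finite_toSet
  let D : (i : ι) → Set (R i) := fun i => if i ∈ s then C i else A i
  have hD : ∀ i, IsCompact (D i) := fun i => by
    by_cases hi : i ∈ s
    · simp only [D, hi, if_true]
      exact hC i hi
    · simp only [D, hi, if_false]
      exact hA i
  have hT : IsCompact (Set.pi Set.univ D) := isCompact_univ_pi hD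
  let coeP : (Πʳ i, [R i, A i]_[𝓟 ((↑s : Set ι)ᶜ)]) → (∀ i, R i) := fun x => (x : ∀ i, R i)
  have hemb : IsEmbedding coeP := RestrictedProduct.isEmbedding_coe_of_principal
  have hT' : IsCompact (coeP ⁻¹' Set.pi Set.univ D) := by
    rw [hemb.isCompact_iff, Set.image_preimage_eq_inter_range]
    have hsub : Set.pi Set.univ D ⊆ Set.range coeP := by
      intro y hy
      rw [show Set.range coeP = Set.range ((↑) : (Πʳ i, [R i, A i]_[𝓟 ((↑s : Set ι)ᶜ)]) → ∀ i, R i)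
        from rfl, RestrictedProduct.range_coe_principal]
      intro i hi
      have := hy i (Set.mem_univ i)
      have hi' : i ∉ s := by simpa using hi
      simpa only [D, hi', if_false] using this
    rw [Set.inter_eq_left.2 hsub]
    exact hT
  have hcont : Continuous (RestrictedProduct.inclusion R A hS) :=
    RestrictedProduct.continuous_inclusion hS
  have heq : {x : Πʳ i, [R i, A i] | (∀ i ∈ s, x i ∈ C i) ∧ ∀ i ∉ s, x i ∈ A i} =
      RestrictedProduct.inclusion R A hS '' (coeP ⁻¹' Set.pi Set.univ D) := by
    ext x
    constructor
    · rintro ⟨h1, h2⟩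
      obtain ⟨y, rfl⟩ := RestrictedProduct.exists_inclusion_eq_of_eventually R A hS
        (x := x) (by
          rw [eventually_principal]
          intro i hi
          exact h2 i (by simpa using hi))
      refine ⟨y, ?_, rfl⟩
      intro i _
      by_cases hi : i ∈ s
      · simp only [D, hi, if_true]
        exact h1 i hi
      · simp only [D, hi, if_false]
        exact h2 i hi
    · rintro ⟨y, hy, rfl⟩
      refine ⟨fun i hi => ?_, fun i hi => ?_⟩
      · have := hy i (Set.mem_univ i)
        simp only [D, hi, if_true] at this
        exact this
      · have := hy i (Set.mem_univ i)
        simp only [D, hi, if_false] at this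
        exact this
  rw [heq]
  exact hT'.image hcont

end RestrictedProductBox

section AdeleBox

variable (k : Type) [Field k] [NumberField k]

/-- **A box in the finite adeles is compact**: `∏_{v ∈ S} C v × ∏_{v ∉ S} 𝓞_v` with `S` finite and `C v` compact. -/
theorem isCompact_finiteAdele_box (S : Finset (HeightOneSpectrum (𝓞 k)))
    (C : ∀ v : HeightOneSpectrum (𝓞 k), Set (v.adicCompletion k)) (hC : ∀ v ∈ S, IsCompact (C v)) :
    IsCompact {x : FiniteAdeleRing (𝓞 k) k |
      (∀ v ∈ S, x v ∈ C v) ∧ ∀ v ∉ S, x v ∈ v.adicCompletionIntegers k} :=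
  isCompact_restrictedProduct_box (R := fun v : HeightOneSpectrum (𝓞 k) => v.adicCompletion k)
    (A := fun v => (v.adicCompletionIntegers k : Set (v.adicCompletion k)))
    (fun v => isCompact_adicCompletionIntegers k v) S C hC

omit [NumberField k] in
/-- **A box in the infinite adeles is compact**: `∏_w C w` with every `C w` compact. -/
theorem isCompact_infiniteAdele_box (C : ∀ w : InfinitePlace k, Set w.Completion)
    (hC : ∀ w, IsCompact (C w)) : IsCompact {x : InfiniteAdeleRing k | ∀ w, x w ∈ C w} := by
  have h := isCompact_univ_pi (ι := InfinitePlace k) (X := fun w => w.Completion) hC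
  have heq : {x : InfiniteAdeleRing k | ∀ w, x w ∈ C w} =
      (Set.pi Set.univ C : Set (∀ w : InfinitePlace k, w.Completion)) := by
    ext x
    exact ⟨fun h w _ => h w, fun h w => h w (Set.mem_univ w)⟩
  rw [heq]
  exact h

/-- **A box in the adele ring is compact**: `∏_w Ci w × ∏_{v ∈ S} Cf v × ∏_{v ∉ S} 𝓞_v`. -/
theorem isCompact_adele_box (S : Finset (HeightOneSpectrum (𝓞 k)))
    (Cf : ∀ v : HeightOneSpectrum (𝓞 k), Set (v.adicCompletion k)) (hCf : ∀ v ∈ S, IsCompact (Cf v))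
    (Ci : ∀ w : InfinitePlace k, Set w.Completion) (hCi : ∀ w, IsCompact (Ci w)) :
    IsCompact {a : Ad k | (∀ w, a.1 w ∈ Ci w) ∧ (∀ v ∈ S, a.2 v ∈ Cf v) ∧
      ∀ v ∉ S, a.2 v ∈ v.adicCompletionIntegers k} := by
  have h := (isCompact_infiniteAdele_box k Ci hCi).prod (isCompact_finiteAdele_box k S Cf hCf)
  have heq : {a : Ad k | (∀ w, a.1 w ∈ Ci w) ∧ (∀ v ∈ S, a.2 v ∈ Cf v) ∧
      ∀ v ∉ S, a.2 v ∈ v.adicCompletionIntegers k} =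
      ({x : InfiniteAdeleRing k | ∀ w, x w ∈ Ci w} ×ˢ {x : FiniteAdeleRing (𝓞 k) k |
        (∀ v ∈ S, x v ∈ Cf v) ∧ ∀ v ∉ S, x v ∈ v.adicCompletionIntegers k} :
        Set (InfiniteAdeleRing k × FiniteAdeleRing (𝓞 k) k)) := by
    ext a
    exact Iff.rfl
  rw [heq]
  exact h

/-- **A box in `M₄(𝔸_k)` is compact**: entrywise membership in compact subsets of `𝔸_k`. -/
theorem isCompact_matrix_box (E : Fin 4 → Fin 4 → Set (Ad k)) (hE : ∀ i j, IsCompact (E i j)) :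
    IsCompact {A : M4 k | ∀ i j, A i j ∈ E i j} := by
  have h : IsCompact (Set.pi Set.univ fun i => Set.pi Set.univ fun j => E i j) :=
    isCompact_univ_pi fun i => isCompact_univ_pi fun j => hE i j
  have heq : {A : M4 k | ∀ i j, A i j ∈ E i j} =
      ((Set.pi Set.univ fun i => Set.pi Set.univ fun j => E i j) : Set (Fin 4 → Fin 4 → Ad k)) := by
    ext A
    exact ⟨fun h i _ j _ => h i j, fun h i j => h i (Set.mem_univ i) j (Set.mem_univ j)⟩
  rw [heq]
  exact h

end AdeleBox

end Summit.Ventures.HodgeRepro.Tier4.Line1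
end
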